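/-
Copyright: lit-balaban Phase-2 proof seat p33 (gen 5).  Statement-level skeleton of a published paper; no proof claims beyond what
the kernel checks below.
-/
import Literature.MathematicalPhysics.QuantumFieldTheory.BalabanImbrieJaffe1984to88.BIJ85Eq7111EdgeAdjoint
import Literature.MathematicalPhysics.QuantumFieldTheory.BalabanImbrieJaffe1984to88.BIJ85Eq715ConfigSymbols
import Literature.MathematicalPhysics.QuantumFieldTheory.BalabanImbrieJaffe1984to88.BIJ85Eq224Base0
import Literature.MathematicalPhysics.QuantumFieldTheory.BalabanImbrieJaffe1984to88.BIJ85Sigma712Torus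
import Literature.MathematicalPhysics.QuantumFieldTheory.Balaban1983to89.B5Eq117TorusCarriers

/-!
# `BalabanImbrieJaffe1984to88.BIJ85Thm711TorusTransport` — T. Bałaban, J. Imbrie, A. Jaffe, *Renormalization of the Higgs model:
minimizers, propagators and the stability of mean field theory*, Commun. Math. Phys. **97** (1985) 299–329 [BalabanImbrieJaffe1985]:
the CARRIER TRANSPORT `Setup ↔ Tor (fine (L^k) Mk)` OF THE DATA OF (4.2.1) — `Q_k` ([Balaban1984PropagatorsI] (1.18)), the curl `∂`,
and the k-fold edge pull-back `Q^{e*}_k` ((2.22) composed k times) — between the `Setup`/`LatticeFieldCalculus` carriers of the torus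
σ_k (`BIJ85Sigma421Torus.sigmaTorus`) and seat p27/p10's `Tor` carriers of the configuration-space Theorem 7.1.1
(`BIJ85Thm711ConfigSpace`), along seat p16's identification `B5Eq117TorusCarriers.EK`; file 1 of 2 (file 2 = `BIJ85Thm711Torus`:
Theorem 7.1.1 for `sigmaTorus` with the k-uniform constant)

statement-level skeleton of published theorems with citation tags; proofs where landed; nothing here is a claim about the Yang–Mills mass gap

PDF held: `paper:balaban1985-cmp97-bij-higgs-minimizers` (journal page = PDF page + 298).  Pages read as images: p. 305 [PDF 7]
(`HOME/lit-balaban-r15/pages/1985-cmp97-bij-higgs-minimizers-p007-x2.png`), p. 310 [PDF 12], pp. 321–322 [PDF 23–24].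

CITATION HEADER (lean-in-tree rule).  Part of the lit-balaban TYPED SKELETON (HOME `run/shared/lean/pub/lit-balaban/`), Phase-2 seat
p33 (gen 5), unit `lit-balaban-p33`; row **C1.Thm7.1.1** of `HOME/SKELETON.md` (owner r15, referee ref-5), whose state of the head
(`HOME/lit-balaban-r15/ROWS-C1.md` v1.29) reads *"… the literal inhabitant `Thm711 (fun k => sigmaTorus …)` still needs the Setup ↔
`Tor (fine n M)` transport of ∂, Q_k, Q^{e*}_k … (iface-2, in no file)"* — supplied HERE (dictionaries) and in file 2 (the theorem); also
rows **C1.Eq2.20-2.23**, **B5.Eq1.18**.  Companion of p16 g3 `B5Eq117TorusCarriers` (`EK : Site P 0 ≃ Tor (fine (L^k) Mk)`, `blockSiteK`,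
`Qk_tV`), p21 `B5TowerOneStroke.cplx_Qk`, p31 g2 `BIJ85Eq224Base0.QestarIter_eq` (`Q^{e*}_k` = the pull-back of the block-size-`L^k` edge
geometry), p27 g5 `BIJ85Eq7111EdgeAdjoint.edgeAdjC_mulVec`, p27 `BIJ85Eq715ConfigSymbols.curlC`, and gen 3's `BIJ85Sigma712Torus.plaqEquiv`.

THE PRINTED TEXT (verbatim).  p. 305 [PDF 7]: *"(Q^{e*}f)(p) = L²f(p′) if p ∈ B^e(p′), 0 otherwise. (2.22) … Especially important
are Q^e_k ≡ (Q^e)^k and Q^s_k = (Q^s)^k"*; p. 321 [PDF 23]: *"functions f_{μν} on plaquettes given as antisymmetric functions on coordinate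
axes μ, ν"*; [Balaban1984PropagatorsI] (1.18) p. 20: *"(Q_kA)_b = Σ_{x∈B^k(b₋)} η^{d+1}A([x, x(b)])"*.

WHAT IS PROVED (0 `sorry`, standard axioms; the `def`s `asym`, `AC`, `fC`, `gC` are transports / reindexings WITH BODIES — no `def … : Prop`, no new named fact, D-0026):
* §0 two-forms: antisymmetrization `asym` of an oriented (`μ < ν`) plaquette field to p27's ordered-pair components and **`Σ‖asym F‖² =
  2Σ‖F‖²`** (`sum_norm_sq_asym`); the η-bond field `A` read on `Tor (fine (L^k) Mk)` through `EK` (`AC`), the unit / η plaquette fields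
  as two-forms (`fC`, `gC`; `fC_antisymm`), `Σ_a‖fC f a‖² = 2Σ_pf(p)²`, `Σ_b‖gC g b‖² = 2Σ_pg(p)²`;
* §1 THE DICTIONARIES along `EK`: **(1.18) `QvOp_AC`** (`B5Block118.QvOp (L^k) Mk *ᵥ AC A` = `bondAvgIter k A` transported; p21 + p16),
  `EK_shift`; **∂: `curlC_AC`** (`curlC *ᵥ AC A = gC (∂_1A)`); the k-block of a shifted block
  point `iterBlockOf_shift_blockSiteK`, membership in p31's k-fold edge set on block coordinates `mem_edgeBTo_blockSiteK_iff`, the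
  ONE-STROKE FORMULA FOR `Q^{e*}_k` ON THE `Setup` CARRIERS **`QestarIter_blockSiteK`** (`(Q^{e*}_kf)(⟨L^k·y + j, μ, ν⟩) =
  L^{2k}f(⟨y, μ, ν⟩)` iff `j_μ = j_ν = L^k − 1`, else `0`), hence **(2.22)_k: `edgeAdjC_fC`** (`edgeAdjC (L^k) Mk *ᵥ fC f = gC (Q^{e*}_kf)`)
  (the combination `n·curlC (AC A) − edgeAdjC (fC f) = gC (∂_{η⁻¹}A − Q^{e*}_kf)` and `Q_kA = 0 ↔ QvOp (AC A) = 0` are in file 2).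
HONEST SCOPE.  Pure transport/reindexing: nothing of the paper is asserted beyond the verbatim operators already in the tree; `U = 1`,
real fields, every `d ≥ 2` (edge carrier), odd `L > 1`, standing range `k ≤ m + K`.
Unit `lit-balaban-p33` (literature-prover-lit-balaban-p33-g5-0), 2026-08-21.
-/

open scoped BigOperators RealInnerProductSpace Matrix

namespace Literature.MathematicalPhysics.QuantumFieldTheory.BalabanImbrieJaffe1984to88.BIJ85Thm711TorusTransport

open Literature.MathematicalPhysics.QuantumFieldTheory.Balaban1983to89
open LatticeFieldCalculus (curl bondAvgIter)
open BIJ85Eq531Inputs (QestarIter)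
open B5Prop11Plancherel (Tor fine unitVec)
open B5Block118 (bpt tstep QvOp)
open B5Eq117TorusCarriers (Mk EK EK_apply blockSiteK val_blockSiteK blockSiteK_mem_iterBlock EK_blockSiteK tV tV_apply tB tB_apply
  eBondK_symm_apply eK_symm_towerE_symm Qk_tV sitesPerDir_zero_eq)
open B5Eq118OneStroke (iterBlockOf iterBlock mem_iterBlock mem_iterBlock_iff)
open BIJ85Eq715ConfigSymbols (curlC curlC_mulVec)
open BIJ85Eq7111EdgeAverage (edgeOffsets mem_edgeOffsets topIdx)
open BIJ85Eq7111EdgeAdjoint (edgeAdjC edgeAdjC_mulVec)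
open BIJ85Sigma712Torus (Orient plaqEquiv plaqEquiv_symm_apply)
open BIJ85AxialPropagator411 BIJ85SigmaForm421 BIJ85Sigma421Torus BIJ85Sect7Statements

noncomputable section

variable {P : Params} {k : ℕ}

/-! ## §0  Two-forms: oriented plaquette fields as antisymmetric ordered-pair components -/

/-- *"functions f_{μν} on plaquettes given as antisymmetric functions on coordinate axes μ, ν which indicates plaquette orientation"*
(p. 321): the two-form with ordered-pair components attached to a field on ORIENTED plaquettes `μ < ν` — `+F_{μν}` for `μ < ν`, `−F_{νμ}`
for `ν < μ`, `0` on the diagonal (the component convention of seat p27's `Tor N × (Fin d × Fin d)` carriers). [cite: BalabanImbrieJaffe1985, (7.1.2) p.321] -/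
def asym {X : Type*} (F : X × Orient P → ℂ) : X × (Fin P.d × Fin P.d) → ℂ := fun a =>
  if h : a.2.1 < a.2.2 then F (a.1, ⟨a.2, h⟩)
  else if h' : a.2.2 < a.2.1 then -F (a.1, ⟨(a.2.2, a.2.1), h'⟩) else 0

/-- `asym F` on an oriented component `μ < ν` is `F_{μν}`. [cite: BalabanImbrieJaffe1985, (7.1.2) p.321] -/
theorem asym_apply_lt {X : Type*} (F : X × Orient P → ℂ) (x : X) {μ ν : Fin P.d} (h : μ < ν) :
    asym F (x, (μ, ν)) = F (x, ⟨(μ, ν), h⟩) := by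
  simp [asym, h]

/-- `asym F` on a reversed component `ν < μ` is `−F_{νμ}`. [cite: BalabanImbrieJaffe1985, (7.1.2) p.321] -/
theorem asym_apply_gt {X : Type*} (F : X × Orient P → ℂ) (x : X) {μ ν : Fin P.d} (h : ν < μ) :
    asym F (x, (μ, ν)) = -F (x, ⟨(ν, μ), h⟩) := by
  simp [asym, h, lt_asymm h]

/-- `asym F` vanishes on the diagonal. [cite: BalabanImbrieJaffe1985, (7.1.2) p.321] -/
theorem asym_apply_self {X : Type*} (F : X × Orient P → ℂ) (x : X) (μ : Fin P.d) : asym F (x, (μ, μ)) = 0 := by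
  simp [asym]

/-- `asym F` is antisymmetric: `(asym F)_{νμ} = −(asym F)_{μν}`. [cite: BalabanImbrieJaffe1985, (7.1.2) p.321] -/
theorem asym_swap {X : Type*} (F : X × Orient P → ℂ) (x : X) (μ ν : Fin P.d) :
    asym F (x, (ν, μ)) = -asym F (x, (μ, ν)) := by
  rcases lt_trichotomy μ ν with h | rfl | h
  · rw [asym_apply_gt F x h, asym_apply_lt F x h]
  · rw [asym_apply_self, neg_zero]
  · rw [asym_apply_lt F x h, asym_apply_gt F x h, neg_neg]

/-- `asym` is linear: `asym (a·F − G) = a·asym F − asym G` componentwise. [cite: BalabanImbrieJaffe1985, (7.1.2) p.321] -/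
theorem asym_smul_sub {X : Type*} (a : ℂ) (F G : X × Orient P → ℂ) (i : X × (Fin P.d × Fin P.d)) :
    asym (fun b => a * F b - G b) i = a * asym F i - asym G i := by
  obtain ⟨x, μ, ν⟩ := i
  rcases lt_trichotomy μ ν with h | rfl | h
  · simp only [asym_apply_lt _ x h]
  · simp only [asym_apply_self, mul_zero, sub_zero]
  · simp only [asym_apply_gt _ x h]; ring

/-- **`Σ_{x,μ,ν}|f_{μν}(x)|² = 2·Σ_{x, μ<ν}|f_{μν}(x)|²`** for a two-form: the ordered-pair sum of squares is twice the oriented-plaquette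
sum. [cite: BalabanImbrieJaffe1985, (7.1.2) p.321] -/
theorem sum_norm_sq_asym {X : Type*} [Fintype X] (F : X × Orient P → ℂ) :
    ∑ a, ‖asym F a‖ ^ 2 = 2 * ∑ b, ‖F b‖ ^ 2 := by
  rw [Fintype.sum_prod_type, Fintype.sum_prod_type, Finset.mul_sum]
  refine Finset.sum_congr rfl fun x _ => ?_
  set h : Fin P.d × Fin P.d → ℝ := fun q => ‖asym F (x, q)‖ ^ 2 with hh
  have hsplit : ∀ q : Fin P.d × Fin P.d, h q = (if q.1 < q.2 then h q else 0) + (if q.2 < q.1 then h q else 0) := by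
    rintro ⟨μ, ν⟩
    rcases lt_trichotomy μ ν with hl | rfl | hl
    · simp [hl, lt_asymm hl]
    · simp [hh, asym_apply_self]
    · simp [hl, lt_asymm hl]
  have hswap : ∑ q : Fin P.d × Fin P.d, (if q.2 < q.1 then h q else 0) = ∑ q : Fin P.d × Fin P.d, (if q.1 < q.2 then h q else 0) := by
    rw [← Equiv.sum_comp (Equiv.prodComm (Fin P.d) (Fin P.d)) (fun q => if q.1 < q.2 then h q else 0)]
    refine Finset.sum_congr rfl fun q _ => ?_
    obtain ⟨μ, ν⟩ := q
    simp only [Equiv.prodComm_apply, Prod.swap_prod_mk, hh, asym_swap F x ν μ, norm_neg]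
  have hsub : ∑ q : Fin P.d × Fin P.d, (if q.1 < q.2 then h q else 0) = ∑ o : Orient P, ‖F (x, o)‖ ^ 2 := by
    rw [← Finset.sum_filter, Finset.sum_subtype (Finset.univ.filter fun q : Fin P.d × Fin P.d => q.1 < q.2)
      (p := fun q : Fin P.d × Fin P.d => q.1 < q.2) (fun q => by simp)]
    refine Finset.sum_congr rfl fun o _ => ?_
    rw [hh]
    simp only
    rw [show ((o : Fin P.d × Fin P.d)) = (o.1.1, o.1.2) from rfl, asym_apply_lt F x o.2]
  calc ∑ q, ‖asym F (x, q)‖ ^ 2 = ∑ q, h q := rfl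
    _ = ∑ q : Fin P.d × Fin P.d, ((if q.1 < q.2 then h q else 0) + (if q.2 < q.1 then h q else 0)) := Finset.sum_congr rfl fun q _ => hsplit q
    _ = 2 * ∑ o : Orient P, ‖F (x, o)‖ ^ 2 := by rw [Finset.sum_add_distrib, hswap, hsub, two_mul]

/-- `L^k ≠ 0` as an instance (the B5 files take the block size as `[NeZero n]`). [cite: Balaban1984PropagatorsI, (1.18) p.20] -/
instance instNeZeroLPow (P : Params) (k : ℕ) : NeZero (P.L ^ k) := ⟨pow_ne_zero _ P.L_pos.ne'⟩

/-- The η-bond field `A` of `T^{(0)} = T_η` READ ON p27's CARRIER `Tor (fine (L^k) Mk) × Fin d → ℂ` through p16's identification `EK`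
(`A_μ(z) = A(⟨EK⁻¹z, μ⟩)`, complexified). [cite: Balaban1984PropagatorsI, (1.18) p.20] -/
def AC (hk : k ≤ P.m + P.K) (A : VecField P 0 ℝ) : Tor (fine (P.L ^ k) (Mk P k)) × Fin P.d → ℂ :=
  fun i => ((A ⟨(EK hk).symm i.1, i.2⟩ : ℝ) : ℂ)

/-- A unit-lattice (`T₁^{(k)} = Balaban1983to89.Site P k = Tor Mk`) plaquette field as a two-form on p27's carrier. [cite: BalabanImbrieJaffe1985, (7.1.2) p.321] -/
def fC (k : ℕ) (f : Plaq P k → ℝ) : Tor (Mk P k) × (Fin P.d × Fin P.d) → ℂ :=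
  asym fun b => ((f ⟨b.1, b.2.1.1, b.2.1.2, b.2.2⟩ : ℝ) : ℂ)

/-- An η-lattice plaquette field as a two-form on `Tor (fine (L^k) Mk)` through `EK`. [cite: BalabanImbrieJaffe1985, (4.2.1) p.310] -/
def gC (hk : k ≤ P.m + P.K) (g : Plaq P 0 → ℝ) : Tor (fine (P.L ^ k) (Mk P k)) × (Fin P.d × Fin P.d) → ℂ :=
  asym fun b => ((g ⟨(EK hk).symm b.1, b.2.1.1, b.2.1.2, b.2.2⟩ : ℝ) : ℂ)

/-- `fC f` is antisymmetric (a two-form, p10's hypothesis `hf`). [cite: BalabanImbrieJaffe1985, (7.1.2) p.321] -/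
theorem fC_antisymm (f : Plaq P k → ℝ) (x : Tor (Mk P k)) (μ ν : Fin P.d) : fC k f (x, (ν, μ)) = -fC k f (x, (μ, ν)) :=
  asym_swap _ x μ ν

/-- `Σ_a|fC f(a)|² = 2·Σ_p f(p)²` (each oriented plaquette counted twice). [cite: BalabanImbrieJaffe1985, (7.1.2) p.321] -/
theorem sum_norm_sq_fC (f : Plaq P k → ℝ) : ∑ a, ‖fC k f a‖ ^ 2 = 2 * ∑ p : Plaq P k, f p ^ 2 := by
  rw [fC, sum_norm_sq_asym]
  congr 1
  refine Fintype.sum_equiv (plaqEquiv P k).symm _ _ fun b => ?_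
  rw [Complex.norm_real, Real.norm_eq_abs, sq_abs, plaqEquiv_symm_apply]

/-- `Σ_b|gC g(b)|² = 2·Σ_p g(p)²` (reindexing by `EK`). [cite: BalabanImbrieJaffe1985, (4.2.1) p.310] -/
theorem sum_norm_sq_gC (hk : k ≤ P.m + P.K) (g : Plaq P 0 → ℝ) : ∑ b, ‖gC hk g b‖ ^ 2 = 2 * ∑ p : Plaq P 0, g p ^ 2 := by
  rw [gC, sum_norm_sq_asym]
  congr 1
  rw [Fintype.sum_prod_type, ← Equiv.sum_comp (EK hk),
    Fintype.sum_equiv (plaqEquiv P 0) (fun p => g p ^ 2) (fun b => g ((plaqEquiv P 0).symm b) ^ 2)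
      (fun p => by rw [Equiv.symm_apply_apply]), Fintype.sum_prod_type]
  refine Finset.sum_congr rfl fun x _ => Finset.sum_congr rfl fun o _ => ?_
  rw [Equiv.symm_apply_apply, Complex.norm_real, Real.norm_eq_abs, sq_abs, plaqEquiv_symm_apply]

/-! ## §1  The dictionaries along `EK`: `Q_k` (1.18), `∂`, `Q^{e*}_k` (2.22)_k -/

/-- **(1.18) IS ONE OPERATOR**: p27/p10's `Q_k = B5Block118.QvOp (L^k)` applied to the transported η-field is the transported
`bondAvgIter k A` (p21's `cplx_Qk` ∘ p16's `Qk_tV`). [cite: Balaban1984PropagatorsI, (1.18) p.20] -/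
theorem QvOp_AC (hk : k ≤ P.m + P.K) (A : VecField P 0 ℝ) :
    QvOp (P.L ^ k) (Mk P k) *ᵥ AC hk A = fun i => ((bondAvgIter k A ⟨i.1, i.2⟩ : ℝ) : ℂ) := by
  have h1 : AC hk A = B5TowerOneStroke.trC (B5TowerOneStroke.towerE P.L (Mk P k) k) (B5SectBStatements.cplx (tV hk A)) := by
    funext i
    simp only [AC, B5TowerOneStroke.trC_apply', B5SectBStatements.cplx, tV_apply, eBondK_symm_apply, eK_symm_towerE_symm]
  rw [h1, ← B5TowerOneStroke.cplx_Qk, Qk_tV]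
  funext i
  rfl

/-- `EK (x + e_μ) = EK x + e_μ` (bonds go to bonds; one `ringEquivCongr` per coordinate). [cite: Balaban1984PropagatorsI, (1.1) p.18] -/
theorem EK_shift (hk : k ≤ P.m + P.K) (x : Balaban1983to89.Site P 0) (μ : Fin P.d) :
    EK hk (x.shift μ) = EK hk x + unitVec (fine (P.L ^ k) (Mk P k)) μ := by
  funext ν
  simp only [EK_apply, Pi.add_apply, unitVec, Balaban1983to89.Site.shift]
  by_cases hν : ν = μ
  · subst hν
    rw [Function.update_self, Pi.single_eq_same, map_add, map_one]
  · rw [Function.update_of_ne hν, Pi.single_eq_of_ne hν, add_zero]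

/-- `EK⁻¹(z + e_μ) = EK⁻¹z + e_μ`. [cite: Balaban1984PropagatorsI, (1.1) p.18] -/
theorem EK_symm_add_unitVec (hk : k ≤ P.m + P.K) (z : Tor (fine (P.L ^ k) (Mk P k))) (μ : Fin P.d) :
    (EK hk).symm (z + unitVec (fine (P.L ^ k) (Mk P k)) μ) = ((EK hk).symm z).shift μ := by
  rw [Equiv.symm_apply_eq, EK_shift, Equiv.apply_symm_apply]

/-- **THE CURL IS ONE OPERATOR**: p27/p10's unit-difference curl `curlC` of the transported field is the transported plaquette variable
`∂_1A` of `LatticeFieldCalculus` (as a two-form). [cite: BalabanImbrieJaffe1985, (7.1.13) p.322] -/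
theorem curlC_AC (hk : k ≤ P.m + P.K) (A : VecField P 0 ℝ) :
    curlC (fine (P.L ^ k) (Mk P k)) *ᵥ AC hk A = gC hk (curl 1 A) := by
  funext i
  obtain ⟨z, μ, ν⟩ := i
  rw [curlC_mulVec]
  simp only [AC, EK_symm_add_unitVec]
  rcases lt_trichotomy μ ν with h | rfl | h
  · rw [gC, asym_apply_lt _ z h]
    simp only [curl, one_smul]
    push_cast
    ring
  · rw [gC, asym_apply_self]
    ring
  · rw [gC, asym_apply_gt _ z h]
    simp only [curl, one_smul]
    push_cast
    ring

/-- `y + e_μ ≠ y` on every torus of the series. [folklore] -/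
private theorem shift_ne_self {j : ℕ} (y : Balaban1983to89.Site P j) (μ : Fin P.d) : y.shift μ ≠ y := by
  intro h
  have h1 := congrFun h μ
  simp only [Balaban1983to89.Site.shift, Function.update_self] at h1
  exact one_ne_zero (add_eq_left.1 h1)

/-- The k-fold block point of a block point: `B^k`-label of `L^k·y + j` is `y`. [cite: Balaban1984PropagatorsI, (1.18) p.20] -/
theorem iterBlockOf_blockSiteK (hk : k ≤ P.m + P.K) (y : Balaban1983to89.Site P k) (j : Fin P.d → Fin (P.L ^ k)) :
    iterBlockOf k (blockSiteK k y j) = y :=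
  (mem_iterBlock k y _).1 (blockSiteK_mem_iterBlock hk y j)

/-- **The k-block of a SHIFTED block point**: `L^k·y + j + e_μ` lies in `B^k(y + e_μ)` if `j_μ = L^k − 1` (the bond leaves the block),
in `B^k(y)` otherwise (standing range; the k-fold form of `BIJ85CurlQsstar.blockOf_shift_blockSite`). [cite: BalabanImbrieJaffe1985, (2.21) p.305] -/
theorem iterBlockOf_shift_blockSiteK (hk : k ≤ P.m + P.K) (y : Balaban1983to89.Site P k) (j : Fin P.d → Fin (P.L ^ k)) (μ : Fin P.d) :
    iterBlockOf k ((blockSiteK k y j).shift μ) = if (j μ : ℕ) + 1 = P.L ^ k then y.shift μ else y := by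
  have hLk : 0 < P.L ^ k := pow_pos P.L_pos k
  symm
  apply ((mem_iterBlock k _ _).1 _).symm
  rw [mem_iterBlock_iff hk]
  intro ν
  by_cases hν : ν = μ
  · subst hν
    have hv : (blockSiteK k y j).shift ν ν = (((y ν).val * P.L ^ k + j ν + 1 : ℕ) : ZMod (P.sitesPerDir 0)) := by
      simp only [Balaban1983to89.Site.shift, Function.update_self, blockSiteK]
      push_cast
      ring
    rw [hv, ZMod.val_natCast]
    split_ifs with hj
    · have h1 : (y ν).val * P.L ^ k + j ν + 1 = ((y ν).val + 1) * P.L ^ k := by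
        rw [add_mul, one_mul, add_assoc, hj]
      rw [h1, sitesPerDir_zero_eq hk, mul_comm (P.L ^ k) (P.sitesPerDir k), Nat.mul_mod_mul_right, Nat.mul_div_cancel _ hLk]
      simp only [Balaban1983to89.Site.shift, Function.update_self]
      rw [ZMod.val_add, ZMod.val_one]
    · have hlt : (j ν : ℕ) + 1 < P.L ^ k := lt_of_le_of_ne (j ν).isLt hj
      have hy : (y ν).val + 1 ≤ P.sitesPerDir k := ZMod.val_lt (y ν)
      have hbound : (y ν).val * P.L ^ k + j ν + 1 < P.sitesPerDir 0 := by
        rw [sitesPerDir_zero_eq hk]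
        have h2 : ((y ν).val + 1) * P.L ^ k ≤ P.sitesPerDir k * P.L ^ k := Nat.mul_le_mul_right _ hy
        nlinarith
      rw [Nat.mod_eq_of_lt hbound, show (y ν).val * P.L ^ k + j ν + 1 = ((j ν : ℕ) + 1) + P.L ^ k * (y ν).val by ring,
        Nat.add_mul_div_left _ _ hLk, Nat.div_eq_of_lt hlt, zero_add]
  · have hv : (blockSiteK k y j).shift μ ν = blockSiteK k y j ν := by
      simp only [Balaban1983to89.Site.shift, Function.update_of_ne hν]
    rw [hv, val_blockSiteK hk, show (y ν).val * P.L ^ k + j ν = (j ν : ℕ) + P.L ^ k * (y ν).val by ring,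
      Nat.add_mul_div_left _ _ hLk, Nat.div_eq_of_lt (j ν).isLt, zero_add]
    split_ifs
    · simp only [Balaban1983to89.Site.shift, Function.update_of_ne hν]
    · rfl

/-- kernel: transporting along an identification of levels `n = n′` commutes with the unit steps. [folklore] -/
private theorem cast_shift {n n' : ℕ} (e : n = n') (z : Balaban1983to89.Site P n) (μ : Fin P.d) :
    cast (congrArg (Balaban1983to89.Site P) e) (z.shift μ) = (cast (congrArg (Balaban1983to89.Site P) e) z).shift μ := by
  subst e
  rfl

/-- kernel: the transport along `n = n′` is injective. [folklore] -/
private theorem cast_inj {n n' : ℕ} (e : n = n') {a b : Balaban1983to89.Site P n} :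
    cast (congrArg (Balaban1983to89.Site P) e) a = cast (congrArg (Balaban1983to89.Site P) e) b ↔ a = b := by
  subst e
  exact Iff.rfl

/-- kernel: p31's base-0 block map (`B7SectAStatements.blockOfIter k` read in `Balaban1983to89.Site P k`) is the tree's `iterBlockOf k`
(`BIJ85Eq224Base0.blk_base0`). [cite: BalabanImbrieJaffe1985, (2.24) p.305] -/
private theorem cast_blockOfIter (k : ℕ) (x : Balaban1983to89.Site P 0) :
    cast (congrArg (Balaban1983to89.Site P) (Nat.zero_add k)) (B7SectAStatements.blockOfIter k x) = iterBlockOf k x :=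
  BIJ85Eq224Base0.blk_base0 k x

/-- kernel: the k-fold "bond leaves the block" condition of p31's edge geometry, read with `iterBlockOf`. [cite: BalabanImbrieJaffe1985, (2.24) p.305] -/
private theorem blockOfIter_shift_iff (k : ℕ) (x : Balaban1983to89.Site P 0) (μ : Fin P.d) :
    B7SectAStatements.blockOfIter k (x.shift μ) = (B7SectAStatements.blockOfIter k x).shift μ ↔
      iterBlockOf k (x.shift μ) = (iterBlockOf k x).shift μ := by
  rw [← cast_inj (Nat.zero_add k), cast_shift (Nat.zero_add k), cast_blockOfIter, cast_blockOfIter]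

/-- **Membership in the k-fold edge set `B^e_k(p′)` of p31's block-size-`L^k` geometry, on block coordinates**: the η-plaquette
`⟨L^k·y + j, μ, ν⟩` is an edge plaquette iff `j_μ = j_ν = L^k − 1`, and then `p′ = ⟨y, μ, ν⟩` (the k-fold form of
`BIJ85CurlQsstar.mem_edgeB_blockSite_iff`; standing range). [cite: BalabanImbrieJaffe1985, (2.21) p.305] -/
theorem mem_edgeBTo_blockSiteK_iff (hd : 2 ≤ P.d) (hk : k ≤ P.m + P.K) (p' : Plaq P k) (y : Balaban1983to89.Site P k)
    (j : Fin P.d → Fin (P.L ^ k)) {μ ν : Fin P.d} (hμν : μ < ν) :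
    (⟨blockSiteK k y j, μ, ν, hμν⟩ : Plaq P 0) ∈ (BIJ85Eq224Base0.torusEdgeCellsTo P 0 k k (Nat.zero_add k) hd).B p' ↔
      p' = ⟨y, μ, ν, hμν⟩ ∧ (j μ : ℕ) + 1 = P.L ^ k ∧ (j ν : ℕ) + 1 = P.L ^ k := by
  rw [BIJ85CellAverages.Cells.mem_B]
  show (if B7SectAStatements.blockOfIter k ((blockSiteK k y j).shift μ) = (B7SectAStatements.blockOfIter k (blockSiteK k y j)).shift μ ∧
      B7SectAStatements.blockOfIter k ((blockSiteK k y j).shift ν) = (B7SectAStatements.blockOfIter k (blockSiteK k y j)).shift ν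
    then some (⟨cast (congrArg (Balaban1983to89.Site P) (Nat.zero_add k)) (B7SectAStatements.blockOfIter k (blockSiteK k y j)),
      μ, ν, hμν⟩ : Plaq P k) else none) = some p' ↔ _
  have hshift : ∀ ρ : Fin P.d, ((if (j ρ : ℕ) + 1 = P.L ^ k then y.shift ρ else y) = y.shift ρ) ↔ (j ρ : ℕ) + 1 = P.L ^ k := by
    intro ρ
    split_ifs with h
    · exact ⟨fun _ => h, fun _ => rfl⟩
    · exact ⟨fun h' => absurd h'.symm (shift_ne_self y ρ), fun h' => absurd h' h⟩
  have hcond : (B7SectAStatements.blockOfIter k ((blockSiteK k y j).shift μ) =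
        (B7SectAStatements.blockOfIter k (blockSiteK k y j)).shift μ ∧
      B7SectAStatements.blockOfIter k ((blockSiteK k y j).shift ν) = (B7SectAStatements.blockOfIter k (blockSiteK k y j)).shift ν) ↔
      ((j μ : ℕ) + 1 = P.L ^ k ∧ (j ν : ℕ) + 1 = P.L ^ k) := by
    rw [blockOfIter_shift_iff, blockOfIter_shift_iff, iterBlockOf_blockSiteK hk, iterBlockOf_shift_blockSiteK hk,
      iterBlockOf_shift_blockSiteK hk, hshift μ, hshift ν]
  have hsrc : cast (congrArg (Balaban1983to89.Site P) (Nat.zero_add k)) (B7SectAStatements.blockOfIter k (blockSiteK k y j)) = y := by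
    rw [cast_blockOfIter, iterBlockOf_blockSiteK hk]
  by_cases hc : B7SectAStatements.blockOfIter k ((blockSiteK k y j).shift μ) =
        (B7SectAStatements.blockOfIter k (blockSiteK k y j)).shift μ ∧
      B7SectAStatements.blockOfIter k ((blockSiteK k y j).shift ν) = (B7SectAStatements.blockOfIter k (blockSiteK k y j)).shift ν
  · rw [if_pos hc, hsrc, Option.some.injEq]
    constructor
    · exact fun h => ⟨h.symm, hcond.1 hc⟩
    · rintro ⟨rfl, -, -⟩
      rfl
  · rw [if_neg hc]
    constructor
    · exact fun h => absurd h (by simp)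
    · rintro ⟨-, h1, h2⟩
      exact absurd (hcond.2 ⟨h1, h2⟩) hc

/-- **THE ONE-STROKE FORMULA FOR `Q^{e*}_k` ON THE `Setup` CARRIERS** — (2.22) composed k times, *"(Q^{e*}f)(p) = L²f(p′) if
p ∈ B^e(p′), 0 otherwise"*: `(Q^{e*}_kf)(⟨L^k·y + j, μ, ν⟩) = L^{2k}·f(⟨y, μ, ν⟩)` if `j_μ = j_ν = L^k − 1`, and `0` otherwise
(`QestarIter` = p30's composite; via p31's `QestarIter_eq`; standing range, `2 ≤ d`). [cite: BalabanImbrieJaffe1985, (2.22) p.305] -/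
theorem QestarIter_blockSiteK (hd : 2 ≤ P.d) (hk : k ≤ P.m + P.K) (f : Plaq P k → ℝ) (y : Balaban1983to89.Site P k) (j : Fin P.d → Fin (P.L ^ k))
    {μ ν : Fin P.d} (hμν : μ < ν) :
    QestarIter hd k f ⟨blockSiteK k y j, μ, ν, hμν⟩ =
      if (j μ : ℕ) + 1 = P.L ^ k ∧ (j ν : ℕ) + 1 = P.L ^ k then ((P.L : ℝ) ^ k) ^ 2 * f ⟨y, μ, ν, hμν⟩ else 0 := by
  rw [BIJ85Eq224Base0.QestarIter_eq hd k hk]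
  split_ifs with hj
  · rw [BIJ85CellAverages.Cells.Qstar_of_mem _ _ ((mem_edgeBTo_blockSiteK_iff hd hk _ y j hμν).2 ⟨rfl, hj⟩)]
    push_cast
    ring
  · refine BIJ85CellAverages.Cells.Qstar_of_not_mem _ _ fun c hc => hj ?_
    exact ((mem_edgeBTo_blockSiteK_iff hd hk c y j hμν).1 hc).2

/-- kernel: `j_μ = L^k − 1 ↔ j_μ + 1 = L^k` (p27's `topIdx`). [cite: BalabanImbrieJaffe1985, (2.21) p.305] -/
private theorem eq_topIdx_iff (i : Fin (P.L ^ k)) : i = topIdx (P.L ^ k) ↔ (i : ℕ) + 1 = P.L ^ k := by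
  rw [Fin.ext_iff]
  show (i : ℕ) = P.L ^ k - 1 ↔ _
  have := i.isLt
  omega

/-- **(2.22)_k IS ONE OPERATOR**: p27's `Q^{e*}_k = edgeAdjC (L^k)` applied to the unit two-form `fC f` is the transported
`Q^{e*}_kf = QestarIter hd k f` (as a two-form on `T_η`; standing range, `2 ≤ d`). [cite: BalabanImbrieJaffe1985, (2.22) p.305] -/
theorem edgeAdjC_fC (hd : 2 ≤ P.d) (hk : k ≤ P.m + P.K) (f : Plaq P k → ℝ) :
    edgeAdjC (P.L ^ k) (Mk P k) *ᵥ fC k f = gC hk (QestarIter hd k f) := by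
  funext i
  obtain ⟨z, μ, ν⟩ := i
  obtain ⟨⟨y, j⟩, rfl⟩ := (B5Blocks16.bpt_bijective (P.L ^ k) (Mk P k)).2 z
  have hx : (EK hk).symm (bpt (P.L ^ k) (Mk P k) y j) = blockSiteK k y j := by
    rw [Equiv.symm_apply_eq, EK_blockSiteK]
  have key : j ∈ edgeOffsets (P.L ^ k) μ ν ↔ (j μ : ℕ) + 1 = P.L ^ k ∧ (j ν : ℕ) + 1 = P.L ^ k := by
    rw [mem_edgeOffsets, eq_topIdx_iff, eq_topIdx_iff]
  simp only
  rw [edgeAdjC_mulVec _ _ hd]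
  rcases lt_trichotomy μ ν with h | rfl | h
  · rw [gC, asym_apply_lt _ _ h, fC, asym_apply_lt _ _ h]
    simp only [hx]
    rw [QestarIter_blockSiteK hd hk f y j h]
    by_cases hj : j ∈ edgeOffsets (P.L ^ k) μ ν
    · rw [if_pos hj, if_pos (key.1 hj)]
      push_cast
      ring
    · rw [if_neg hj, if_neg (fun h' => hj (key.2 h'))]
      simp
  · rw [gC, asym_apply_self, fC, asym_apply_self]
    split_ifs <;> simp
  · rw [gC, asym_apply_gt _ _ h, fC, asym_apply_gt _ _ h]
    simp only [hx]
    rw [QestarIter_blockSiteK hd hk f y j h]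
    by_cases hj : j ∈ edgeOffsets (P.L ^ k) μ ν
    · rw [if_pos hj, if_pos ⟨(key.1 hj).2, (key.1 hj).1⟩]
      push_cast
      ring
    · rw [if_neg hj, if_neg (fun h' => hj (key.2 ⟨h'.2, h'.1⟩))]
      simp

end

end Literature.MathematicalPhysics.QuantumFieldTheory.BalabanImbrieJaffe1984to88.BIJ85Thm711TorusTransport
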